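import Literature.NumberTheory.Sieve.GrimmeltMerikoski2025TrivialRange
import Literature.NumberTheory.Sieve.GrimmeltMerikoski2025Restricted
import HarnessLib

/-!
# Grimmelt–Merikoski 2025, Theorem 1.4: the trivial Type I bound and the diagonal `D ≥ X^{1/2-δ}`

L. Grimmelt, J. Merikoski, *On the greatest prime factor and uniform equidistribution of quadratic
polynomials*, arXiv:2505.00493 [GrimmeltMerikoski2025], Theorem 1.4 (Type I estimate), vendored
in the range its proof treats as the named fact
`Literature.NumberTheory.Sieve.grimmeltMerikoski2025_thm14_restricted`.  After Theorem 1.5 the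
paper records that the Type I bound `D X^{1/2}(1 + X/D²)^θ` "is non-trivial in the range
`D < X^{1/2}`" (§1.2, p. 5).  This file PROVES the corresponding *trivial bound* for the tree's
Type I form and the sliver of Theorem 1.4 in which the printed bound is the weaker one:

* `GM2025.sum_sum_filter_dvd_le`: `∑_{d ≤ M} ∑_{k ≤ N, d ∣ k} f(k) ≤ ∑_{k ≤ N} τ(k) f(k)` (`f ≥ 0`);
* `GM2025.sum_card_divisors_mul_card_filter_le`: the incidence count
  `∑_{k ≤ N} τ(k) #{ℓ ∈ W : k ∣ n_ℓ} ≤ ∑_{ℓ ∈ W} τ(n_ℓ)²` (`n_ℓ ≠ 0`) — "divisor switching";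
* `GM2025.exists_typeISum_le` — **the trivial Type I bound**: for every `η > 0` there is `C`
  with `typeISum ≤ C B² X ((aX² + h)^η + K^η)` for `X, K ≥ 1`, square-free `h ≥ 1`,
  `gcd(a, h) = 1` and admissible `ψ₁, ψ₂` with `|ψᵢ| ≤ B` (the root sums contribute
  `≤ B² ∑_{|ℓ| ≤ ⌈X⌉} τ(aℓ²+h)²`, the main terms `≤ 2B² (X/K) ∑_{k ≤ 2K} τ(k) ϱ(k)`, and
  `τ, ϱ ≺≺ 1` by `exists_card_divisors_le_mul_rpow'`, `GM2025.exists_rho_le_mul_rpow`) — in the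
  paper's notation `typeISum ≺≺ X` uniformly in `D` and `K ≤ X^{O(1)}`;
* `grimmeltMerikoski2025_thm14_diagonal` — **Theorem 1.4 at the diagonal `D ≥ X^{1/2-δ}`**
  (PROVED): the statement of `grimmeltMerikoski2025_thm14_restricted` with the one extra
  hypothesis `X^{1/2-δ} ≤ D`; there the right-hand side is `≥ X^ε D X^{1/2} ≥ X^{1+ε-δ}`, which
  dominates the trivial bound `X^{1+O(δ)}`.

What is NOT here: Theorem 1.4 for `D ≤ X^{1/2-δ}` and `X^{1-η} < K` (the content of the paper,
[GMtechnical, Thm 2.1]); the Poisson range `K ≤ X^{1-η}` is `grimmeltMerikoski2025_thm14_poissonRange`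
(`GrimmeltMerikoski2025TypeIPoissonRange.lean`).

## References

* [GrimmeltMerikoski2025] arXiv:2505.00493, Theorem 1.4; §1.2 (p. 5: "non-trivial in the range
  `D < X^{1/2}`").
-/

noncomputable section

namespace Literature.NumberTheory.Sieve

open Finset MeasureTheory

namespace GM2025

/-! ### Two counting lemmas -/

/-- `∑_{1 ≤ d ≤ M} ∑_{1 ≤ k ≤ N, d ∣ k} f(k) ≤ ∑_{1 ≤ k ≤ N} τ(k) f(k)` for `f ≥ 0` (swap the sums;
the `d ≤ M` dividing `k ≥ 1` are among the `τ(k)` divisors of `k`). [folklore] -/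
theorem sum_sum_filter_dvd_le {f : ℕ → ℝ} (hf : ∀ k, 0 ≤ f k) (M N : ℕ) :
    ∑ d ∈ Icc 1 M, ∑ k ∈ (Icc 1 N).filter (fun k : ℕ => d ∣ k), f k ≤
      ∑ k ∈ Icc 1 N, (#k.divisors : ℝ) * f k := by
  calc ∑ d ∈ Icc 1 M, ∑ k ∈ (Icc 1 N).filter (fun k : ℕ => d ∣ k), f k
      = ∑ d ∈ Icc 1 M, ∑ k ∈ Icc 1 N, if d ∣ k then f k else 0 := by
        refine sum_congr rfl fun d _ => ?_
        rw [sum_filter]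
    _ = ∑ k ∈ Icc 1 N, ∑ d ∈ Icc 1 M, if d ∣ k then f k else 0 := sum_comm
    _ = ∑ k ∈ Icc 1 N, (#((Icc 1 M).filter (fun d : ℕ => d ∣ k)) : ℝ) * f k := by
        refine sum_congr rfl fun k _ => ?_
        rw [← sum_filter, sum_const, nsmul_eq_mul]
    _ ≤ ∑ k ∈ Icc 1 N, (#k.divisors : ℝ) * f k := by
        refine sum_le_sum fun k hk => mul_le_mul_of_nonneg_right ?_ (hf k)
        have hk0 : k ≠ 0 := by have := (mem_Icc.mp hk).1; omega
        exact_mod_cast card_le_card fun d hd =>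
          Nat.mem_divisors.mpr ⟨(mem_filter.mp hd).2, hk0⟩

/-- **Divisor switching for incidences**: for a finite set `W` and nonzero integers `n_ℓ`,
`∑_{1 ≤ k ≤ N} τ(k) #{ℓ ∈ W : k ∣ n_ℓ} ≤ ∑_{ℓ ∈ W} τ(|n_ℓ|)²`
(swap the sums; the `k ∣ n_ℓ` are divisors of `|n_ℓ|`, each with `τ(k) ≤ τ(|n_ℓ|)`). [folklore] -/
theorem sum_card_divisors_mul_card_filter_le (W : Finset ℤ) {n : ℤ → ℤ}
    (hn : ∀ ℓ ∈ W, n ℓ ≠ 0) (N : ℕ) :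
    ∑ k ∈ Icc 1 N, (#k.divisors : ℝ) * #(W.filter (fun ℓ : ℤ => (k : ℤ) ∣ n ℓ)) ≤
      ∑ ℓ ∈ W, ((#(n ℓ).natAbs.divisors : ℝ)) ^ 2 := by
  calc ∑ k ∈ Icc 1 N, (#k.divisors : ℝ) * #(W.filter (fun ℓ : ℤ => (k : ℤ) ∣ n ℓ))
      = ∑ k ∈ Icc 1 N, ∑ ℓ ∈ W, if (k : ℤ) ∣ n ℓ then (#k.divisors : ℝ) else 0 := by
        refine sum_congr rfl fun k _ => ?_
        rw [← sum_filter, sum_const, nsmul_eq_mul, mul_comm]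
    _ = ∑ ℓ ∈ W, ∑ k ∈ Icc 1 N, if (k : ℤ) ∣ n ℓ then (#k.divisors : ℝ) else 0 := sum_comm
    _ = ∑ ℓ ∈ W, ∑ k ∈ (Icc 1 N).filter (fun k : ℕ => (k : ℤ) ∣ n ℓ), (#k.divisors : ℝ) := by
        refine sum_congr rfl fun ℓ _ => ?_
        rw [sum_filter]
    _ ≤ ∑ ℓ ∈ W, ∑ k ∈ (n ℓ).natAbs.divisors, (#k.divisors : ℝ) := by
        refine sum_le_sum fun ℓ hℓ => sum_le_sum_of_subset_of_nonneg (fun k hk => ?_)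
          (fun _ _ _ => Nat.cast_nonneg _)
        have hkd : (k : ℤ) ∣ n ℓ := (mem_filter.mp hk).2
        exact Nat.mem_divisors.mpr ⟨Int.natCast_dvd.mp hkd, Int.natAbs_ne_zero.mpr (hn ℓ hℓ)⟩
    _ ≤ ∑ ℓ ∈ W, ∑ k ∈ (n ℓ).natAbs.divisors, (#(n ℓ).natAbs.divisors : ℝ) := by
        refine sum_le_sum fun ℓ hℓ => sum_le_sum fun k hk => ?_
        have h0 : (n ℓ).natAbs ≠ 0 := Int.natAbs_ne_zero.mpr (hn ℓ hℓ)
        exact_mod_cast card_le_card (Nat.divisors_subset_of_dvd h0 (Nat.dvd_of_mem_divisors hk))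
    _ = ∑ ℓ ∈ W, ((#(n ℓ).natAbs.divisors : ℝ)) ^ 2 := by
        refine sum_congr rfl fun ℓ _ => ?_
        rw [sum_const, nsmul_eq_mul, sq]

/-! ### The trivial Type I bound -/

/-- **The trivial Type I bound** ("the bounds are then non-trivial as long as …", i.e. what one
gets without any cancellation; [GrimmeltMerikoski2025, §1.2] "non-trivial in the range
`D < X^{1/2}`"): for every `η > 0` there is `C ≥ 1` such that for square-free `h ≥ 1`,
`gcd(a, h) = 1`, admissible `ψ₁` on `[1, 2]` and `ψ₂` on `[-1, 1]` with `|ψᵢ| ≤ B`, `X ≥ 1`,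
`K ≥ 1` and any `D`,
`∑_{d ≤ D} |∑_{k ≡ 0 (d)} ψ₁(k/K) disc_{a,h}(k; ψ₂, X)| ≤ C B² X ((aX² + h)^η + K^η)`.
The root sums contribute `≤ B² ∑_k τ(k) #{|ℓ| ≤ ⌈X⌉ : k ∣ aℓ²+h} ≤ B² ∑_{|ℓ| ≤ ⌈X⌉} τ(aℓ²+h)²`
(divisor switching) and the main terms, supported on `K ≤ k ≤ 2K`,
`≤ 2B² (X/K) ∑_{k ≤ 2K} τ(k) ϱ_{a,h}(k)`; finally `τ(n) ≤ C₁ n^{η/2}` and `ϱ_{a,h}(k) ≤ C₂ k^{η/2}`.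
[folklore] -/
theorem exists_typeISum_le {η : ℝ} (hη : 0 < η) : ∃ C : ℝ, 1 ≤ C ∧
    ∀ (a h : ℕ), 1 ≤ h → Squarefree h → a.Coprime h →
    ∀ (ψ₁ ψ₂ : ℝ → ℂ) (J : ℕ) (B : ℝ), IsAdmissibleWeight ψ₁ 1 2 J B →
      IsAdmissibleWeight ψ₂ (-1) 1 J B →
    ∀ (X K D : ℝ), 1 ≤ X → 1 ≤ K →
      typeISum a h ψ₁ ψ₂ X K D ≤ C * B ^ 2 * X * (((a : ℝ) * X ^ 2 + h) ^ η + K ^ η) := by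
  obtain ⟨C₁, hC₁1, hC₁⟩ := exists_card_divisors_le_mul_rpow' (half_pos hη)
  obtain ⟨C₂, hC₂1, hC₂⟩ := exists_rho_le_mul_rpow (half_pos hη)
  have hC₁0 : 0 ≤ C₁ := zero_le_one.trans hC₁1
  have hC₂0 : 0 ≤ C₂ := zero_le_one.trans hC₂1
  have h4η : (1 : ℝ) ≤ 4 ^ η := Real.one_le_rpow (by norm_num) hη.le
  have h2η : (1 : ℝ) ≤ 2 ^ η := Real.one_le_rpow (by norm_num) hη.le
  refine ⟨5 * C₁ ^ 2 * 4 ^ η + 4 * C₁ * C₂ * 2 ^ η, ?_, ?_⟩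
  · nlinarith [one_le_pow₀ (n := 2) hC₁1, mul_nonneg (mul_nonneg hC₁0 hC₂0) (zero_le_one.trans h2η)]
  intro a h hh1 hh hah ψ₁ ψ₂ J B hψ₁ hψ₂ X K D hX1 hK1
  have hB0 : 0 ≤ B := hψ₂.bound_nonneg
  have hX0 : 0 < X := by linarith
  have hK0 : 0 < K := by linarith
  set N : ℕ := ⌊2 * K⌋₊ with hN
  set W : Finset ℤ := Icc (-⌈X⌉) ⌈X⌉ with hW
  set n : ℤ → ℤ := fun ℓ => (a : ℤ) * ℓ ^ 2 + (h : ℤ) with hn_def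
  have hnpos : ∀ ℓ : ℤ, 0 < n ℓ := fun ℓ => by
    simp only [hn_def]; have : (1 : ℤ) ≤ h := by exact_mod_cast hh1
    nlinarith [sq_nonneg ℓ, Int.natCast_nonneg a]
  -- Step 1: split the discrepancy and pull out `ψ₁`
  set M : ℕ → ℝ := fun k => ‖((rho a h k : ℂ) / (k : ℂ)) * (X : ℂ) * ∫ u, ψ₂ u‖ with hM
  have hsplit : typeISum a h ψ₁ ψ₂ X K D ≤
      ∑ d ∈ Icc 1 ⌊D⌋₊, ∑ k ∈ (Icc 1 N).filter (fun k : ℕ => d ∣ k),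
        (B * ‖rootSum a h k ψ₂ X‖ + ‖ψ₁ ((k : ℝ) / K)‖ * M k) := by
    unfold typeISum
    refine sum_le_sum fun d _ => (norm_sum_le _ _).trans (sum_le_sum fun k _ => ?_)
    rw [norm_mul, rootDiscrepancy]
    calc ‖ψ₁ ((k : ℝ) / K)‖ * ‖rootSum a h k ψ₂ X - ((rho a h k : ℂ) / (k : ℂ)) * (X : ℂ) * ∫ u, ψ₂ u‖
        ≤ ‖ψ₁ ((k : ℝ) / K)‖ * (‖rootSum a h k ψ₂ X‖ + M k) :=
          mul_le_mul_of_nonneg_left (norm_sub_le _ _) (norm_nonneg _)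
      _ ≤ B * ‖rootSum a h k ψ₂ X‖ + ‖ψ₁ ((k : ℝ) / K)‖ * M k := by
          rw [mul_add]
          gcongr
          exact hψ₁.norm_le _
  -- Step 2: the root sums, by divisor switching
  have hroot : ∀ k : ℕ, ‖rootSum a h k ψ₂ X‖ ≤ B * #(W.filter (fun ℓ : ℤ => (k : ℤ) ∣ n ℓ)) := by
    intro k
    unfold rootSum
    calc ‖∑ ℓ ∈ W.filter (fun ℓ : ℤ => (k : ℤ) ∣ (a : ℤ) * ℓ ^ 2 + (h : ℤ)), ψ₂ ((ℓ : ℝ) / X)‖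
        ≤ ∑ ℓ ∈ W.filter (fun ℓ : ℤ => (k : ℤ) ∣ (a : ℤ) * ℓ ^ 2 + (h : ℤ)), ‖ψ₂ ((ℓ : ℝ) / X)‖ :=
          norm_sum_le _ _
      _ ≤ ∑ ℓ ∈ W.filter (fun ℓ : ℤ => (k : ℤ) ∣ (a : ℤ) * ℓ ^ 2 + (h : ℤ)), B :=
          sum_le_sum fun ℓ _ => hψ₂.norm_le _
      _ = B * #(W.filter (fun ℓ : ℤ => (k : ℤ) ∣ n ℓ)) := by
          rw [sum_const, nsmul_eq_mul, mul_comm]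
  have hτn : ∀ ℓ ∈ W, ((#(n ℓ).natAbs.divisors : ℝ)) ^ 2 ≤
      C₁ ^ 2 * 4 ^ η * ((a : ℝ) * X ^ 2 + h) ^ η := by
    intro ℓ hℓ
    have hℓX : |(ℓ : ℝ)| ≤ 2 * X := by
      have h1 : -⌈X⌉ ≤ ℓ ∧ ℓ ≤ ⌈X⌉ := by simpa [hW] using hℓ
      have h2 : ((⌈X⌉ : ℤ) : ℝ) < X + 1 := Int.ceil_lt_add_one X
      have h3 : (((-⌈X⌉ : ℤ)) : ℝ) ≤ (ℓ : ℝ) := by exact_mod_cast h1.1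
      have h4 : ((ℓ : ℤ) : ℝ) ≤ ((⌈X⌉ : ℤ) : ℝ) := by exact_mod_cast h1.2
      push_cast at h3
      rw [abs_le]; constructor <;> linarith
    have hnR : (((n ℓ).natAbs : ℕ) : ℝ) ≤ 4 * ((a : ℝ) * X ^ 2 + h) := by
      have e1 : (((n ℓ).natAbs : ℕ) : ℝ) = ((n ℓ : ℤ) : ℝ) := by
        rw [Nat.cast_natAbs, Int.cast_abs, abs_of_pos (by exact_mod_cast hnpos ℓ)]
      rw [e1]
      simp only [hn_def]
      push_cast
      have hsq : ((ℓ : ℝ)) ^ 2 ≤ (2 * X) ^ 2 := by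
        rw [← sq_abs]; exact pow_le_pow_left₀ (abs_nonneg _) hℓX 2
      have ha0 : (0 : ℝ) ≤ a := Nat.cast_nonneg a
      have hh0 : (0 : ℝ) ≤ h := Nat.cast_nonneg h
      nlinarith [mul_le_mul_of_nonneg_left hsq ha0]
    have h0 : (n ℓ).natAbs ≠ 0 := Int.natAbs_ne_zero.mpr (hnpos ℓ).ne'
    calc ((#(n ℓ).natAbs.divisors : ℝ)) ^ 2 ≤ (C₁ * (((n ℓ).natAbs : ℕ) : ℝ) ^ (η / 2)) ^ 2 :=
          pow_le_pow_left₀ (Nat.cast_nonneg _) (hC₁ _) 2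
      _ = C₁ ^ 2 * (((n ℓ).natAbs : ℕ) : ℝ) ^ η := by
          rw [mul_pow, ← Real.rpow_natCast (_ ^ (η / 2)) 2, ← Real.rpow_mul (Nat.cast_nonneg _)]
          norm_num
      _ ≤ C₁ ^ 2 * (4 * ((a : ℝ) * X ^ 2 + h)) ^ η := by
          gcongr
      _ = C₁ ^ 2 * 4 ^ η * ((a : ℝ) * X ^ 2 + h) ^ η := by
          rw [Real.mul_rpow (by norm_num) (by positivity)]; ring
  have hcardW : (#W : ℝ) ≤ 5 * X := by
    have h1 : #W = (⌈X⌉ + 1 + ⌈X⌉).toNat := by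
      rw [hW, Int.card_Icc]; congr 1; ring
    have h2 : (0 : ℤ) ≤ ⌈X⌉ := Int.ceil_nonneg hX0.le
    have h3 : ((#W : ℕ) : ℤ) = 2 * ⌈X⌉ + 1 := by rw [h1, Int.toNat_of_nonneg (by omega)]; ring
    have h4 : (#W : ℝ) = 2 * ((⌈X⌉ : ℤ) : ℝ) + 1 := by exact_mod_cast h3
    rw [h4]
    have h5 : ((⌈X⌉ : ℤ) : ℝ) < X + 1 := Int.ceil_lt_add_one X
    linarith
  have hA : ∑ d ∈ Icc 1 ⌊D⌋₊, ∑ k ∈ (Icc 1 N).filter (fun k : ℕ => d ∣ k),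
      B * ‖rootSum a h k ψ₂ X‖ ≤ 5 * C₁ ^ 2 * 4 ^ η * B ^ 2 * X * ((a : ℝ) * X ^ 2 + h) ^ η := by
    calc ∑ d ∈ Icc 1 ⌊D⌋₊, ∑ k ∈ (Icc 1 N).filter (fun k : ℕ => d ∣ k), B * ‖rootSum a h k ψ₂ X‖
        ≤ ∑ k ∈ Icc 1 N, (#k.divisors : ℝ) * (B * ‖rootSum a h k ψ₂ X‖) :=
          sum_sum_filter_dvd_le (fun k => by positivity) _ _
      _ ≤ ∑ k ∈ Icc 1 N, (#k.divisors : ℝ) * (B * (B * #(W.filter (fun ℓ : ℤ => (k : ℤ) ∣ n ℓ)))) :=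
          sum_le_sum fun k _ => mul_le_mul_of_nonneg_left
            (mul_le_mul_of_nonneg_left (hroot k) hB0) (Nat.cast_nonneg _)
      _ = B ^ 2 * ∑ k ∈ Icc 1 N, (#k.divisors : ℝ) * #(W.filter (fun ℓ : ℤ => (k : ℤ) ∣ n ℓ)) := by
          rw [mul_sum]; refine sum_congr rfl fun k _ => ?_; ring
      _ ≤ B ^ 2 * ∑ ℓ ∈ W, ((#(n ℓ).natAbs.divisors : ℝ)) ^ 2 :=
          mul_le_mul_of_nonneg_left
            (sum_card_divisors_mul_card_filter_le W (fun ℓ _ => (hnpos ℓ).ne') N) (sq_nonneg B)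
      _ ≤ B ^ 2 * ∑ ℓ ∈ W, C₁ ^ 2 * 4 ^ η * ((a : ℝ) * X ^ 2 + h) ^ η :=
          mul_le_mul_of_nonneg_left (sum_le_sum hτn) (sq_nonneg B)
      _ = B ^ 2 * (#W * (C₁ ^ 2 * 4 ^ η * ((a : ℝ) * X ^ 2 + h) ^ η)) := by
          rw [sum_const, nsmul_eq_mul]
      _ ≤ B ^ 2 * ((5 * X) * (C₁ ^ 2 * 4 ^ η * ((a : ℝ) * X ^ 2 + h) ^ η)) := by
          gcongr
      _ = _ := by ring
  -- Step 3: the main terms, supported on `K ≤ k ≤ 2K`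
  have hmain : ∀ k ∈ Icc 1 N, ‖ψ₁ ((k : ℝ) / K)‖ * M k ≤ 2 * B ^ 2 * X / K * rho a h k := by
    intro k hk
    have hk1 : (1 : ℝ) ≤ k := by exact_mod_cast (mem_Icc.mp hk).1
    by_cases hψ0 : ψ₁ ((k : ℝ) / K) = 0
    · rw [hψ0, norm_zero, zero_mul]; positivity
    · have hKk : K ≤ k := by
        have := (hψ₁.2.1 _ hψ0).1
        rwa [le_div_iff₀ hK0, one_mul] at this
      have hMk : M k ≤ (rho a h k : ℝ) / k * X * (2 * B) := by
        simp only [hM]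
        rw [norm_mul, norm_mul, norm_div, Complex.norm_natCast, Complex.norm_natCast,
          Complex.norm_real, Real.norm_eq_abs, abs_of_pos hX0]
        have hint : ‖∫ u, ψ₂ u‖ ≤ 2 * B := by
          have := hψ₂.norm_integral_le (by norm_num : (-1 : ℝ) ≤ 1); linarith
        exact mul_le_mul_of_nonneg_left hint (by positivity)
      calc ‖ψ₁ ((k : ℝ) / K)‖ * M k ≤ B * ((rho a h k : ℝ) / k * X * (2 * B)) :=
            mul_le_mul (hψ₁.norm_le _) hMk (norm_nonneg _) hB0
        _ = 2 * B ^ 2 * X * ((rho a h k : ℝ) / k) := by ring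
        _ ≤ 2 * B ^ 2 * X * ((rho a h k : ℝ) / K) := by
            gcongr
        _ = 2 * B ^ 2 * X / K * rho a h k := by ring
  have hNK : (N : ℝ) ≤ 2 * K := Nat.floor_le (by positivity)
  have hτρ : ∀ k ∈ Icc 1 N, (#k.divisors : ℝ) * rho a h k ≤ C₁ * C₂ * (2 * K) ^ η := by
    intro k hk
    have hk0 : k ≠ 0 := by have := (mem_Icc.mp hk).1; omega
    have hkK : (k : ℝ) ≤ 2 * K := (Nat.cast_le.mpr (mem_Icc.mp hk).2).trans hNK
    calc (#k.divisors : ℝ) * rho a h k ≤ (C₁ * (k : ℝ) ^ (η / 2)) * (C₂ * (k : ℝ) ^ (η / 2)) :=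
          mul_le_mul (hC₁ k) (hC₂ a h k hh hah hk0) (Nat.cast_nonneg _) (by positivity)
      _ = C₁ * C₂ * (k : ℝ) ^ η := by
          rw [show (η : ℝ) = η / 2 + η / 2 by ring, Real.rpow_add (by positivity)]; ring
      _ ≤ C₁ * C₂ * (2 * K) ^ η := by gcongr
  have hBsum : ∑ d ∈ Icc 1 ⌊D⌋₊, ∑ k ∈ (Icc 1 N).filter (fun k : ℕ => d ∣ k),
      ‖ψ₁ ((k : ℝ) / K)‖ * M k ≤ 4 * C₁ * C₂ * 2 ^ η * B ^ 2 * X * K ^ η := by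
    calc ∑ d ∈ Icc 1 ⌊D⌋₊, ∑ k ∈ (Icc 1 N).filter (fun k : ℕ => d ∣ k), ‖ψ₁ ((k : ℝ) / K)‖ * M k
        ≤ ∑ k ∈ Icc 1 N, (#k.divisors : ℝ) * (‖ψ₁ ((k : ℝ) / K)‖ * M k) :=
          sum_sum_filter_dvd_le (fun k => by positivity) _ _
      _ ≤ ∑ k ∈ Icc 1 N, (#k.divisors : ℝ) * (2 * B ^ 2 * X / K * rho a h k) :=
          sum_le_sum fun k hk => mul_le_mul_of_nonneg_left (hmain k hk) (Nat.cast_nonneg _)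
      _ = 2 * B ^ 2 * X / K * ∑ k ∈ Icc 1 N, (#k.divisors : ℝ) * rho a h k := by
          rw [mul_sum]; refine sum_congr rfl fun k _ => ?_; ring
      _ ≤ 2 * B ^ 2 * X / K * ∑ k ∈ Icc 1 N, C₁ * C₂ * (2 * K) ^ η :=
          mul_le_mul_of_nonneg_left (sum_le_sum hτρ) (by positivity)
      _ = 2 * B ^ 2 * X / K * (N * (C₁ * C₂ * (2 * K) ^ η)) := by
          rw [sum_const, nsmul_eq_mul, Nat.card_Icc, Nat.add_sub_cancel]
      _ ≤ 2 * B ^ 2 * X / K * ((2 * K) * (C₁ * C₂ * (2 * K) ^ η)) := by gcongr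
      _ = 4 * C₁ * C₂ * 2 ^ η * B ^ 2 * X * K ^ η := by
          rw [Real.mul_rpow (by norm_num) hK0.le]; field_simp; ring
  -- Step 4: combine
  have hP1 : 0 ≤ ((a : ℝ) * X ^ 2 + h) ^ η := by positivity
  have hP2 : 0 ≤ K ^ η := by positivity
  calc typeISum a h ψ₁ ψ₂ X K D ≤ _ := hsplit
    _ = (∑ d ∈ Icc 1 ⌊D⌋₊, ∑ k ∈ (Icc 1 N).filter (fun k : ℕ => d ∣ k), B * ‖rootSum a h k ψ₂ X‖) +
        ∑ d ∈ Icc 1 ⌊D⌋₊, ∑ k ∈ (Icc 1 N).filter (fun k : ℕ => d ∣ k), ‖ψ₁ ((k : ℝ) / K)‖ * M k := by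
        rw [← sum_add_distrib]; refine sum_congr rfl fun d _ => sum_add_distrib
    _ ≤ 5 * C₁ ^ 2 * 4 ^ η * B ^ 2 * X * ((a : ℝ) * X ^ 2 + h) ^ η +
        4 * C₁ * C₂ * 2 ^ η * B ^ 2 * X * K ^ η := add_le_add hA hBsum
    _ ≤ (5 * C₁ ^ 2 * 4 ^ η + 4 * C₁ * C₂ * 2 ^ η) * B ^ 2 * X * (((a : ℝ) * X ^ 2 + h) ^ η + K ^ η) := by
        have hB2X : 0 ≤ B ^ 2 * X := by positivity
        nlinarith [mul_nonneg (mul_nonneg (by positivity : (0:ℝ) ≤ 5 * C₁ ^ 2 * 4 ^ η) hB2X) hP2,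
          mul_nonneg (mul_nonneg (by positivity : (0:ℝ) ≤ 4 * C₁ * C₂ * 2 ^ η) hB2X) hP1]

end GM2025

open GM2025

/-! ### Theorem 1.4 at the diagonal `D ≥ X^{1/2-δ}` -/

/-- **Grimmelt–Merikoski 2025, Theorem 1.4 at the diagonal `X^{1/2-δ} ≤ D ≤ X^{1/2}`** (PROVED;
the statement of `grimmeltMerikoski2025_thm14_restricted` verbatim with the one extra hypothesis
`X^{1/2-δ} ≤ D` after `D ≤ X^{1/2}`).  In this sliver the printed bound is the weaker one: the
right-hand side is `≥ X^ε D X^{1/2} ≥ X^{1+ε-δ}`, while by the trivial Type I bound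
(`GM2025.exists_typeISum_le` with `η = δ = min(ε,1)/10`, `a ≤ X^δ`, `h ≤ X^{2+δ}`, `K ≤ X²`,
`|ψᵢ| ≤ X^δ`) the Type I form is `≤ 3C X^{1+2δ+(2+δ)η} ≤ X^{1+ε-δ}` for `X ≥ X₀(ε)` — the paper's
remark that the Type I bound "is non-trivial in the range `D < X^{1/2}`"
([GrimmeltMerikoski2025, §1.2, p. 5]).  The range `D ≤ X^{1/2-δ}`, `K > X^{1-η}` is the content
of the paper and is NOT proved in the tree.
[cite: GrimmeltMerikoski2025, Theorem 1.4 and §1.2 (p. 5)] -/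
theorem grimmeltMerikoski2025_thm14_diagonal :
    ∀ ε : ℝ, 0 < ε → ∃ δ : ℝ, 0 < δ ∧ ∃ J : ℕ, ∃ X₀ : ℝ, ∀ X : ℝ, X₀ ≤ X →
    ∀ D K : ℝ, 1 ≤ D → D ≤ K → K ≤ X ^ 2 → K ≤ D * X ^ (1 + δ) → D ≤ X ^ (1 / 2 : ℝ) →
      X ^ (1 / 2 - δ) ≤ D →
    ∀ h : ℕ, 1 ≤ h → Squarefree h → (h : ℝ) ≤ X ^ (2 + δ) →
    ∀ a : ℕ, 1 ≤ a → (a : ℝ) ≤ X ^ δ → Nat.Coprime a h →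
    ∀ ψ₁ ψ₂ : ℝ → ℂ, IsAdmissibleWeight ψ₁ 1 2 J (X ^ δ) →
      IsAdmissibleWeight ψ₂ (-1) 1 J (X ^ δ) →
      typeISum a h ψ₁ ψ₂ X K D ≤
        X ^ ε * (D ^ (1 / 2 : ℝ) * X ^ (1 / 2 : ℝ) * (D ^ (1 / 2 : ℝ) + (h : ℝ) ^ (1 / 4 : ℝ)) *
          (1 + X / (D * (D + (h : ℝ) ^ (1 / 2 : ℝ)))) ^ (7 / 64 : ℝ)) := by
  intro ε hε
  set m : ℝ := min ε 1 with hm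
  have hm0 : 0 < m := lt_min hε one_pos
  have hm1 : m ≤ 1 := min_le_right _ _
  have hmε : m ≤ ε := min_le_left _ _
  obtain ⟨C, hC1, hC⟩ := exists_typeISum_le (η := m / 10) (by positivity)
  have hC0 : 0 < C := by linarith
  refine ⟨m / 10, by positivity, 0, max 1 ((3 * C) ^ (1 / (0.49 * m))), ?_⟩
  intro X hX D K hD1 _ hKX _ _ hXD h hh1 hh hhX a _ haX hah ψ₁ ψ₂ hψ₁ hψ₂
  have hX1 : (1 : ℝ) ≤ X := (le_max_left _ _).trans hX
  have hXC : (3 * C) ^ (1 / (0.49 * m)) ≤ X := (le_max_right _ _).trans hX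
  have hX0 : (0 : ℝ) < X := by linarith
  have hD0 : (0 : ℝ) < D := by linarith
  have hK1 : (1 : ℝ) ≤ K := by linarith
  have htriv := hC a h hh1 hh hah ψ₁ ψ₂ 0 (X ^ (m / 10)) hψ₁ hψ₂ X K D hX1 hK1
  -- the size of `(aX² + h)^η + K^η`
  have hah2 : (a : ℝ) * X ^ 2 + h ≤ 2 * X ^ (2 + m / 10) := by
    have h1 : (a : ℝ) * X ^ 2 ≤ X ^ (m / 10) * X ^ 2 :=
      mul_le_mul_of_nonneg_right haX (by positivity)
    have h2 : X ^ (m / 10) * X ^ 2 = X ^ (2 + m / 10) := by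
      rw [← Real.rpow_natCast X 2, ← Real.rpow_add hX0]; norm_num; ring_nf
    linarith
  have hexp : 2 * (m / 10) ≤ (2 + m / 10) * (m / 10) := by nlinarith
  have hsum : ((a : ℝ) * X ^ 2 + h) ^ (m / 10) + K ^ (m / 10) ≤
      3 * X ^ ((2 + m / 10) * (m / 10)) := by
    have h1 : ((a : ℝ) * X ^ 2 + h) ^ (m / 10) ≤ 2 * X ^ ((2 + m / 10) * (m / 10)) := by
      calc ((a : ℝ) * X ^ 2 + h) ^ (m / 10) ≤ (2 * X ^ (2 + m / 10)) ^ (m / 10) :=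
            Real.rpow_le_rpow (by positivity) hah2 (by positivity)
        _ = 2 ^ (m / 10) * X ^ ((2 + m / 10) * (m / 10)) := by
            rw [Real.mul_rpow (by norm_num) (by positivity), ← Real.rpow_mul hX0.le]
        _ ≤ 2 ^ (1 : ℝ) * X ^ ((2 + m / 10) * (m / 10)) := by
            gcongr
            · norm_num
            · linarith
        _ = 2 * X ^ ((2 + m / 10) * (m / 10)) := by rw [Real.rpow_one]
    have h2 : K ^ (m / 10) ≤ X ^ ((2 + m / 10) * (m / 10)) := by
      calc K ^ (m / 10) ≤ (X ^ 2) ^ (m / 10) := Real.rpow_le_rpow (by linarith) hKX (by positivity)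
        _ = X ^ (2 * (m / 10)) := by rw [← Real.rpow_natCast X 2, ← Real.rpow_mul hX0.le]; norm_num
        _ ≤ X ^ ((2 + m / 10) * (m / 10)) := Real.rpow_le_rpow_of_exponent_le hX1 hexp
    linarith
  -- hence `typeISum ≤ 3C X^{1 + 0.41 m}`
  have hexp2 : 2 * (m / 10) + 1 + (2 + m / 10) * (m / 10) ≤ 1 + 0.41 * m := by nlinarith
  have hT : typeISum a h ψ₁ ψ₂ X K D ≤ 3 * C * X ^ (1 + 0.41 * m) := by
    calc typeISum a h ψ₁ ψ₂ X K D
        ≤ C * (X ^ (m / 10)) ^ 2 * X * (((a : ℝ) * X ^ 2 + h) ^ (m / 10) + K ^ (m / 10)) := htriv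
      _ ≤ C * (X ^ (m / 10)) ^ 2 * X * (3 * X ^ ((2 + m / 10) * (m / 10))) := by gcongr
      _ = 3 * C * X ^ (2 * (m / 10) + 1 + (2 + m / 10) * (m / 10)) := by
          rw [← Real.rpow_natCast (X ^ (m / 10)) 2, ← Real.rpow_mul hX0.le, Real.rpow_add hX0,
            Real.rpow_add hX0, Real.rpow_one]
          ring
      _ ≤ 3 * C * X ^ (1 + 0.41 * m) :=
          mul_le_mul_of_nonneg_left (Real.rpow_le_rpow_of_exponent_le hX1 hexp2) (by positivity)
  -- and `3C X^{1 + 0.41 m} ≤ X^ε D X^{1/2} ≤` the right-hand side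
  have h3C : 3 * C ≤ X ^ (0.49 * m) := by
    have e1 : 1 / (0.49 * m) * (0.49 * m) = 1 := by field_simp
    calc 3 * C = ((3 * C) ^ (1 / (0.49 * m))) ^ (0.49 * m) := by
          rw [← Real.rpow_mul (by positivity), e1, Real.rpow_one]
      _ ≤ X ^ (0.49 * m) := Real.rpow_le_rpow (by positivity) hXC (by positivity)
  have hlow : 3 * C * X ^ (1 + 0.41 * m) ≤ X ^ ε * D * X ^ (1 / 2 : ℝ) := by
    have e1 : 0.49 * m + (1 + 0.41 * m) = m + (1 / 2 - m / 10) + 1 / 2 := by ring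
    calc 3 * C * X ^ (1 + 0.41 * m) ≤ X ^ (0.49 * m) * X ^ (1 + 0.41 * m) := by gcongr
      _ = X ^ m * X ^ (1 / 2 - m / 10) * X ^ (1 / 2 : ℝ) := by
          rw [← Real.rpow_add hX0, ← Real.rpow_add hX0, ← Real.rpow_add hX0, e1]
      _ ≤ X ^ ε * D * X ^ (1 / 2 : ℝ) := by gcongr
  have hDD : D ^ (1 / 2 : ℝ) * D ^ (1 / 2 : ℝ) = D := by
    rw [← Real.rpow_add hD0]; norm_num
  have hRHS : X ^ ε * D * X ^ (1 / 2 : ℝ) ≤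
      X ^ ε * (D ^ (1 / 2 : ℝ) * X ^ (1 / 2 : ℝ) * (D ^ (1 / 2 : ℝ) + (h : ℝ) ^ (1 / 4 : ℝ)) *
        (1 + X / (D * (D + (h : ℝ) ^ (1 / 2 : ℝ)))) ^ (7 / 64 : ℝ)) := by
    have hP : (1 : ℝ) ≤ (1 + X / (D * (D + (h : ℝ) ^ (1 / 2 : ℝ)))) ^ (7 / 64 : ℝ) :=
      Real.one_le_rpow (le_add_of_nonneg_right (by positivity)) (by norm_num)
    have hh4 : (0 : ℝ) ≤ (h : ℝ) ^ (1 / 4 : ℝ) := by positivity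
    have e2 : D ^ (1 / 2 : ℝ) * X ^ (1 / 2 : ℝ) * D ^ (1 / 2 : ℝ) * 1 = D * X ^ (1 / 2 : ℝ) := by
      rw [mul_one, mul_right_comm, hDD]
    calc X ^ ε * D * X ^ (1 / 2 : ℝ)
        = X ^ ε * (D ^ (1 / 2 : ℝ) * X ^ (1 / 2 : ℝ) * D ^ (1 / 2 : ℝ) * 1) := by
          rw [e2]; ring
      _ ≤ _ := by
          gcongr
          · linarith
  exact hT.trans (hlow.trans hRHS)

end Literature.NumberTheory.Sieve

end
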